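import Summits.ABC.IUTFork.Joshi.ATS1ConnectednessCohomology
import Mathlib.GroupTheory.QuotientGroup.Basic
import HarnessLib

/-!
# Joshi's ATS I (arXiv:2106.11452v4) §5.7–§5.10: the subspaces `𝔍_Σ`, `𝔍_hyp`, `𝔍_SB` (Prop. 5.8.1, 5.8.2), the `Aut(Π)`-action
# on them (Prop. 5.9.1) and its descent to `Out(Π)` on isomorphism classes (Prop. 5.10.1) — typed over E-t1's carriers

Block E of the abc-iut cell (rung LADDER-ABC:A2.E; seat abc-iut-E-t21, slot T-48 of the [J-I] fan-out, E-plan-2 07:04:11Z; E-t1's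
veto window closed 07:20Z without veto; inventory `plan/E/t21/INVENTORY-T48.tsv`; the §5.11/§5.20/§5.24 rows are the companion file
`ATS1PairsCorrespondences`). SOURCE: K. Joshi, *Construction of Arithmetic Teichmüller Spaces I*, arXiv:2106.11452**v4** (UNREFEREED
«Preliminary version»; bib `Joshi2021ATS1`; the series is rejected by the IUT author, `Mochizuki2024JoshiReport`). Locators «p.N
l.a–b» = PDF page N, lines of the cell's render `plan/repair/lit/renders/Joshi-ATS1-2106.11452v4-PDFpaged-book-anonnd/pNNNN.txt`;
node ids = v4 ids of plan/E/JOSHI-DAG.tsv. TAKES NO SIDE on [IUTchIII] Cor. 3.12, on Joshi's claims, or on Mochizuki's report;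
typed ≠ proved; typed AS A CANDIDATE ≠ endorsed. What print ASSERTS is a `Prop`-valued `def` tagged `@[claim "Joshi2021ATS1"
"disputed"]` (E-t1's registered key and status word), never an axiom, instance, `sorry` or Literature fact; what FOLLOWS is PROVED.

CARRIERS (imported BY NAME, never re-typed; fan-out rules r1–r3): E-t1's `ATSObj X` = objects of `𝔍(X,E)` with `Iso`, `IsIso`,
`geomSubgroup`, `relabel`, `StrictBelyiRigidity`, and `UntiltPoints`, `ATSObjF` (p428170, p429850); E-t13's `ATSObj.strictBelyiSub
IsSB X` = `𝔍_SB(X,E)` (ATS1ConnectednessCohomology). Curves are behind the [SemiAnbd] §6 interface `TemperedCurve p`, so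
«hyperbolic», «of strict Belyi type», «topological type» are ABSTRACT predicates/invariants (parameters), as in E-t1/E-t13.

WHAT IS TYPED. (5.7.1) `𝔍_Σ` = `subcat`; §5.8 `𝔍_hyp` = `Jhyp`; `𝔍_SB` = E-t13's `strictBelyiSub` (Σ_Belyi's conjunct «hyperbolic» is
implied by strict Belyi type, [Mochizuki 2013, Def. 3.5]: `strictBelyiSub_subset_Jhyp`); Prop. 5.8.1 (1) claim `SameTopologicalType`;
(2) claim `PreservesGeomSubgroup` (= the content of the cited [Mochizuki 2004, Lem. 1.3.8] on the interface) with the printed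
conclusion «`G_{E′} ≃ G_E`» DERIVED (`galoisEquivOfGeomSubgroupEq`: `Π/Δ ≅ range(aug) = G_K`); Prop. 5.8.2 «`𝔍_SB = 𝔍_hyp`» DERIVED
from its proof's input typed as claim `StrictBelyiDescends`; Rmk. 5.8.3 recorded; Prop. 5.9.1 (1) = E-t1's `StrictBelyiRigidity`
(POINTER), (2) = E-t1's `relabel` — here: the subspaces are STABLE (`relabel_mem_*_iff`) and `relabel` is functorial on isomorphisms
(`Iso.relabel`), (3) claim `SBNonIsomorphic` + its derivation from E-t1's `UntiltPoints.ActionChangesTopology`; **Prop. 5.10.1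
«natural action of `Out(Π)` on `𝔍_SB(X,E)`» DISCHARGED in substance**: `Iso.symm`/`Iso.trans` (so `IsIso` is an equivalence,
`isoSetoid`), INNER automorphisms relabel an object to an ISOMORPHIC one (`isIso_relabel_conj`, conjugating inside `Π^temp_Y` by
`α⁻¹(g)`), hence the action on isomorphism classes `relabelClass` has `relabelClass_conj = id` — it FACTORS THROUGH `Out(Π) =
Aut(Π)/Inn(Π)` on all of `𝔍(X,E)`, a fortiori on the stable `𝔍_SB` (print's strict-Belyi hypothesis serves to realise it on the ONE
scheme `Y ≅ X` of Prop. 5.9.1 (1)). Standard axioms only; sorry-free.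
-/

noncomputable section

open Set

namespace Summit.ABC.IUTFork.Joshi

open Literature.AnabelianGeometry.SemiGraphs (TemperedCurve)

variable {p : ℕ} [Fact p.Prime]

namespace ATSObj

/-! ## 1. (5.7.1), §5.8: `𝔍_Σ(X,E)`, `𝔍_hyp(X,E)`, `𝔍_SB(X,E)`; Prop. 5.8.1; Prop. 5.8.2 -/

/-- **(5.7.1) `𝔍_Σ(X,E)`** (J1:§5.7, p.28 l.21–28: «the full subcategory of `𝔍(X,E)` consisting of objects of `𝔍(X,E)` which satisfy
`Σ`», `Σ` «a (finite) set of geometric or arithmetic conditions one can impose on the data `(Y/E′ ↪ K)`»): a full subcategory as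
the set of objects satisfying a predicate. [claim: Joshi2021ATS1, status: disputed] -/
@[claim "Joshi2021ATS1" "disputed"]
def subcat {X : TemperedCurve p} (Sig : ATSObj X → Prop) : Set (ATSObj X) := {A | Sig A}

/-- Membership in `𝔍_Σ`. [folklore] -/
theorem mem_subcat_iff {X : TemperedCurve p} {Sig : ATSObj X → Prop} {A : ATSObj X} : A ∈ subcat Sig ↔ Sig A := Iff.rfl

/-- **`𝔍_hyp(X,E)`** (J1:§5.8 (1), p.28 l.31–32 / p.29 l.1–2: «`Σ_hyp = {Y/E′ is hyperbolic}` … `𝔍_hyp(X,E) = {(Y/E′, E′ ↪ K) ∈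
𝔍(X,E) : Y/E′ is hyperbolic variety}`»), over an ABSTRACT predicate «hyperbolic» on the curve interface. [claim: Joshi2021ATS1, status: disputed] -/
@[claim "Joshi2021ATS1" "disputed"]
def Jhyp (IsHyp : TemperedCurve p → Prop) (X : TemperedCurve p) : Set (ATSObj X) := subcat fun A => IsHyp A.Y

/-- `𝔍_SB(X,E)` of J1:§5.8 (2) (p.28 l.33–34 / p.29 l.3–4: «`Σ_Belyi = {Y hyperbolic and also of strict Belyi Type}`»,
[Mochizuki 2013, Def. 3.5]) IS E-t13's `strictBelyiSub IsSB X` (imported); if the abstract «strict Belyi type» implies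
«hyperbolic» (as in print), it lies inside `𝔍_hyp`. [folklore] -/
theorem strictBelyiSub_subset_Jhyp {IsHyp IsSB : TemperedCurve p → Prop} (hSB : ∀ Y : TemperedCurve p, IsSB Y → IsHyp Y)
    (X : TemperedCurve p) : strictBelyiSub IsSB X ⊆ Jhyp IsHyp X := fun A hA => hSB A.Y hA

/-- CLAIM **Prop. 5.8.1 (1)** (J1:Prop5.8.1(1), p.29 l.5–9): for `X/E` a hyperbolic curve and `(Y/E′, …) ∈ 𝔍_hyp(X,E)`, «`Y/E′` has
the same topological type = (genus, number of punctures) as that of `X/E`» (proof: [Mochizuki, 2004, Lemma 1.3.9]) — over an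
abstract invariant `topType` of the curve interface. HYPOTHESIS, never asserted. [claim: Joshi2021ATS1, status: disputed] -/
@[claim "Joshi2021ATS1" "disputed"]
def SameTopologicalType (IsHyp : TemperedCurve p → Prop) (topType : TemperedCurve p → ℕ × ℕ) (X : TemperedCurve p) : Prop :=
  IsHyp X → ∀ A ∈ Jhyp IsHyp X, topType A.Y = topType X

/-- CLAIM, the content of [Mochizuki, 2004, Lemma 1.3.8] as **Prop. 5.8.1 (2)** uses it (J1:Prop5.8.1(2), p.29 l.10–23: «any
anabelomorphism `Π^temp_{Y/E′} ≃ Π^temp_{X/E}` provides an anabelomorphism `G_{E′} ≃ G_E`»): for hyperbolic curves the label `α`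
carries the geometric subgroup `Δ^temp_Y = ker(Π^temp_Y → G_{E′})` ONTO `Δ^temp_X` (E-t1's `geomSubgroup A = α(Δ^temp_Y)`).
HYPOTHESIS, never asserted; the printed conclusion is DERIVED below. [claim: Joshi2021ATS1, status: disputed] -/
@[claim "Joshi2021ATS1" "disputed"]
def PreservesGeomSubgroup (IsHyp : TemperedCurve p → Prop) (X : TemperedCurve p) : Prop :=
  IsHyp X → ∀ A ∈ Jhyp IsHyp X, A.geomSubgroup = X.DeltaTemp

/-- **Prop. 5.8.1 (2) DERIVED**: if the label carries `Δ^temp_Y` onto `Δ^temp_X`, the base fields are anabelomorphic —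
`G_{E′} ≃ G_E` as abstract groups — via `Π^temp_Y/Δ^temp_Y ≅ Π^temp_X/Δ^temp_X` and `Π^temp/Δ^temp ≅ range(aug) = G_K` (the [SemiAnbd] §6
interface fields `aug`, `range_aug`). (The Krull topology is not tracked on the interface's `GK`.) [folklore] -/
def galoisEquivOfGeomSubgroupEq {X : TemperedCurve p} (A : ATSObj X) (h : A.geomSubgroup = X.DeltaTemp) : A.Y.GK ≃* X.GK := by
  haveI h1 : A.Y.DeltaTemp.Normal := MonoidHom.normal_ker _
  haveI h2 : X.DeltaTemp.Normal := MonoidHom.normal_ker _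
  have h' : A.Y.DeltaTemp.map (A.α.toMulEquiv : A.Y.PiTemp →* X.PiTemp) = X.DeltaTemp := h
  exact ((MulEquiv.subgroupCongr A.Y.range_aug).symm.trans
    ((QuotientGroup.quotientKerEquivRange A.Y.aug.toMonoidHom).symm.trans
      (QuotientGroup.congr A.Y.DeltaTemp X.DeltaTemp A.α.toMulEquiv h'))).trans
    ((QuotientGroup.quotientKerEquivRange X.aug.toMonoidHom).trans (MulEquiv.subgroupCongr X.range_aug))

/-- Prop. 5.8.1 (2) from the claim: every object of `𝔍_hyp` has base field anabelomorphic to `E`. [folklore] -/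
theorem nonempty_galoisEquiv_of_preserves {IsHyp : TemperedCurve p → Prop} {X : TemperedCurve p}
    (h : PreservesGeomSubgroup IsHyp X) (hX : IsHyp X) (A : ATSObj X) (hA : A ∈ Jhyp IsHyp X) : Nonempty (A.Y.GK ≃* X.GK) :=
  ⟨galoisEquivOfGeomSubgroupEq A (h hX A hA)⟩

/-- CLAIM, the input of the proof of **Prop. 5.8.2** (p.29 l.27–31: «if `X/E` is of Strict Belyi Type, then every hyperbolic curve
`Y/E′` occurring as a part of the datum of any object of `𝔍_hyp(X,E)` is also of Strict Belyi Type», from Prop. 5.5.1, the proof of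
[Mochizuki, 2007b, Thm. 2.10] and [ibid., Def. 2.9]). HYPOTHESIS, never asserted. [claim: Joshi2021ATS1, status: disputed] -/
@[claim "Joshi2021ATS1" "disputed"]
def StrictBelyiDescends (IsHyp IsSB : TemperedCurve p → Prop) (X : TemperedCurve p) : Prop :=
  IsSB X → ∀ A ∈ Jhyp IsHyp X, IsSB A.Y

/-- CLAIM **Prop. 5.8.2** (J1:Prop5.8.2, p.29 l.24–26): «Let `X/E` be a geometrically connected, smooth, hyperbolic curve … also of
Strict Belyi Type. Then `𝔍_SB(X,E) = 𝔍_hyp(X,E)`.» (with «strict Belyi ⇒ hyperbolic», which print takes as read, for `⊆`).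
[claim: Joshi2021ATS1, status: disputed] -/
@[claim "Joshi2021ATS1" "disputed"]
def Prop582 (IsHyp IsSB : TemperedCurve p → Prop) (X : TemperedCurve p) : Prop :=
  (∀ Y : TemperedCurve p, IsSB Y → IsHyp Y) → IsSB X → strictBelyiSub IsSB X = Jhyp IsHyp X

/-- Prop. 5.8.2 DERIVED from its proof's input. [folklore] -/
theorem prop582_of {IsHyp IsSB : TemperedCurve p → Prop} {X : TemperedCurve p} (h : StrictBelyiDescends IsHyp IsSB X) :
    Prop582 IsHyp IsSB X := fun hSB hX =>
  Subset.antisymm (strictBelyiSub_subset_Jhyp hSB X) fun A hA => h hX A hA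

/-! ## 2. §5.9: the `Aut(Π)`-action (E-t1's `relabel`) preserves the subspaces and is functorial on isomorphisms

Rmk. 5.8.3 (p.29 l.32–35): «for a geometrically connected, smooth, hyperbolic curve, `𝔍_hyp(X/E)` has properties similar to
classical Teichmüller Spaces: namely local scalings (Theorem 5.4.1, Corollary 5.4.2), the topological types of all objects and the
tempered fundamental group … is fixed by Proposition 5.8.1» — recorded, not typed. Prop. 5.9.1 (1) is E-t1's
`ATSObj.StrictBelyiRigidity IsSB IsoSch X` (p429850) — POINTER, not restated. -/

variable {X : TemperedCurve p}

/-- **Prop. 5.9.1 (2)** (p.30 l.1–2: «one has a natural action of `Aut(Π)` on `𝔍_SB(X,E)`») at the level of E-t1's relabelling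
action `relabel σ : (Y, K, α) ↦ (Y, K, σ ∘ α)`: every subspace `𝔍_Σ` cut out by a condition invariant under relabelling — in
particular one on `(Y/E′, E′ ↪ K)` only: `𝔍_hyp`, `𝔍_SB`, `𝔍(X,E)_F` — is STABLE. [folklore] -/
theorem relabel_mem_subcat_iff {Sig : ATSObj X → Prop} (hSig : ∀ A (σ : X.PiTemp ≃ₜ* X.PiTemp), Sig (relabel σ A) ↔ Sig A)
    (σ : X.PiTemp ≃ₜ* X.PiTemp) (A : ATSObj X) : relabel σ A ∈ subcat Sig ↔ A ∈ subcat Sig := hSig A σ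

/-- `𝔍_SB` is stable under the `Aut(Π)`-action (the curve is unchanged: `(relabel σ A).Y = A.Y`). [folklore] -/
theorem relabel_mem_strictBelyiSub_iff (IsSB : TemperedCurve p → Prop) (σ : X.PiTemp ≃ₜ* X.PiTemp) (A : ATSObj X) :
    relabel σ A ∈ strictBelyiSub IsSB X ↔ A ∈ strictBelyiSub IsSB X := Iff.rfl

/-- `𝔍_hyp` is stable under the `Aut(Π)`-action. [folklore] -/
theorem relabel_mem_Jhyp_iff (IsHyp : TemperedCurve p → Prop) (σ : X.PiTemp ≃ₜ* X.PiTemp) (A : ATSObj X) :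
    relabel σ A ∈ Jhyp IsHyp X ↔ A ∈ Jhyp IsHyp X := Iff.rfl

/-- Inverse of an isomorphism of triples (E-t1's `Iso`). [folklore] -/
def Iso.symm {A B : ATSObj X} (e : Iso A B) : Iso B A where
  baseEquiv := e.baseEquiv.symm
  fieldEquiv := e.fieldEquiv.symm
  emb_comm x := by
    have h := e.emb_comm (e.baseEquiv.symm x)
    rw [RingEquiv.apply_symm_apply] at h
    show e.fieldEquiv.toRingEquiv.symm (B.emb x) = A.emb (e.baseEquiv.symm x)
    rw [← h, RingEquiv.symm_apply_apply]
  piEquiv := e.piEquiv.symm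
  α_comm g := by
    have h := e.α_comm (e.piEquiv.symm g)
    rw [ContinuousMulEquiv.apply_symm_apply] at h
    exact h.symm

/-- Composite of isomorphisms of triples. [folklore] -/
def Iso.trans {A B C : ATSObj X} (e : Iso A B) (f : Iso B C) : Iso A C where
  baseEquiv := e.baseEquiv.trans f.baseEquiv
  fieldEquiv := e.fieldEquiv.trans f.fieldEquiv
  emb_comm x := by
    show f.fieldEquiv.toRingEquiv (e.fieldEquiv.toRingEquiv (A.emb x)) = C.emb (f.baseEquiv (e.baseEquiv x))
    rw [e.emb_comm, f.emb_comm]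
  piEquiv := e.piEquiv.trans f.piEquiv
  α_comm g := by
    show C.α (f.piEquiv (e.piEquiv g)) = A.α g
    rw [f.α_comm, e.α_comm]

/-- `IsIso` is symmetric. [folklore] -/
theorem IsIso.symm {A B : ATSObj X} (h : A.IsIso B) : B.IsIso A := ⟨h.some.symm⟩

/-- `IsIso` is transitive. [folklore] -/
theorem IsIso.trans {A B C : ATSObj X} (h : A.IsIso B) (h' : B.IsIso C) : A.IsIso C := ⟨h.some.trans h'.some⟩

/-- The `Aut(Π)`-action is functorial on isomorphisms: `A ≅ B ⇒ σ·A ≅ σ·B`. [folklore] -/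
def Iso.relabel {A B : ATSObj X} (e : Iso A B) (σ : X.PiTemp ≃ₜ* X.PiTemp) : Iso (relabel σ A) (relabel σ B) where
  baseEquiv := e.baseEquiv
  fieldEquiv := e.fieldEquiv
  emb_comm := e.emb_comm
  piEquiv := e.piEquiv
  α_comm g := by
    show σ (B.α (e.piEquiv g)) = σ (A.α g)
    rw [e.α_comm]

/-- CLAIM **Prop. 5.9.1 (3)** (p.30 l.3–8: «two such triples `(Y/E′, E′ ↪ K)`, `(Y″/E″, E″ ↪ K′) ∈ 𝔍_SB(X,E)` may not be isomorphic
in general», «immediate from Proposition 4.1.7»): `𝔍_SB(X,E)` has two non-isomorphic objects. HYPOTHESIS, never asserted; see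
`sbNonIsomorphic_of`. [claim: Joshi2021ATS1, status: disputed] -/
@[claim "Joshi2021ATS1" "disputed"]
def SBNonIsomorphic (IsSB : TemperedCurve p → Prop) (X : TemperedCurve p) : Prop :=
  ∃ A ∈ strictBelyiSub IsSB X, ∃ B ∈ strictBelyiSub IsSB X, ¬ A.IsIso B

/-- Prop. 5.9.1 (3) DERIVED modulo E-t1's typed claim `ActionChangesTopology` (some `σ ∈ Aut_{𝒪_E}(𝒢(𝒪_F))` moves a point to a
non-homeomorphic untilt): for `X` of strict Belyi type the labeled objects `(X, σ(y))`, `(X, y)` lie in `𝔍_SB` and are not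
isomorphic (E-t1's `not_isIso_of_not_topIso`). [folklore] -/
theorem sbNonIsomorphic_of {IsSB : TemperedCurve p → Prop} {𝒪E : Type} [CommRing 𝒪E] (D : UntiltPoints p 𝒪E)
    (hD : D.ActionChangesTopology) (hX : IsSB X) : SBNonIsomorphic IsSB X := by
  obtain ⟨σ, y, hne⟩ := hD
  exact ⟨(ATSObjF.labeled X D (D.ptAct σ y)).toObj, hX, (ATSObjF.labeled X D y).toObj, hX, not_isIso_of_not_topIso hne⟩

/-! ## 3. §5.10: inner automorphisms act trivially up to isomorphism — the action descends to `Out(Π)` (Prop. 5.10.1) -/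

/-- Conjugation by `g` as a TOPOLOGICAL automorphism of a topological group (the inner automorphisms `Inn(Π) ⊆ Aut(Π)`). [folklore] -/
def conjEquiv {G : Type*} [Group G] [TopologicalSpace G] [IsTopologicalGroup G] (g : G) : G ≃ₜ* G :=
  { MulAut.conj g with
    continuous_toFun := IsTopologicalGroup.continuous_conj g
    continuous_invFun := by
      show Continuous fun h : G => g⁻¹ * h * g
      exact (continuous_mul_const g).comp (continuous_const_mul g⁻¹) }

/-- `conjEquiv g h = g h g⁻¹`. [folklore] -/
theorem conjEquiv_apply {G : Type*} [Group G] [TopologicalSpace G] [IsTopologicalGroup G] (g h : G) :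
    conjEquiv g h = g * h * g⁻¹ := rfl

/-- **Toward Prop. 5.10.1: inner automorphisms act trivially up to isomorphism.** Relabelling an object `(Y, K, α)` by the INNER
automorphism `Inn(g)` of `Π = Π^temp_{X/E}` gives an ISOMORPHIC object: conjugation by `α⁻¹(g)` inside `Π^temp_Y` is an isomorphism of
triples `(Y, K, Inn(g) ∘ α) ≅ (Y, K, α)`. [folklore] -/
def isoRelabelConj (A : ATSObj X) (g : X.PiTemp) : Iso (relabel (conjEquiv g) A) A where
  baseEquiv := RingEquiv.refl _
  fieldEquiv := Untilt.TopEquiv.refl A.U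
  emb_comm _ := rfl
  piEquiv := conjEquiv (A.α.symm g)
  α_comm h := by
    show A.α (conjEquiv (A.α.symm g) h) = conjEquiv g (A.α h)
    rw [conjEquiv_apply, conjEquiv_apply, map_mul, map_mul, map_inv, ContinuousMulEquiv.apply_symm_apply]

/-- `Inn(g)·A ≅ A`. [folklore] -/
theorem isIso_relabel_conj (A : ATSObj X) (g : X.PiTemp) : (relabel (conjEquiv g) A).IsIso A := ⟨isoRelabelConj A g⟩

variable (X)

/-- Isomorphism of triples as a setoid on the objects of `𝔍(X,E)` (E-t1's `IsIso`; reflexive by E-t1, symmetric/transitive above).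
[folklore] -/
def isoSetoid : Setoid (ATSObj X) where
  r A B := A.IsIso B
  iseqv := ⟨IsIso.refl, IsIso.symm, IsIso.trans⟩

/-- Isomorphism classes of objects of `𝔍(X,E)`. [folklore] -/
def IsoClass : Type 1 := Quotient (isoSetoid X)

variable {X}

/-- The `Aut(Π)`-action on isomorphism classes (well defined by `Iso.relabel`). [folklore] -/
def relabelClass (σ : X.PiTemp ≃ₜ* X.PiTemp) : IsoClass X → IsoClass X :=
  Quotient.map (relabel σ) fun _ _ h => ⟨h.some.relabel σ⟩

/-- The class of `σ·A` is `σ·[A]`. [folklore] -/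
theorem relabelClass_mk (σ : X.PiTemp ≃ₜ* X.PiTemp) (A : ATSObj X) :
    relabelClass σ (Quotient.mk (isoSetoid X) A) = Quotient.mk (isoSetoid X) (relabel σ A) := rfl

/-- **Prop. 5.10.1 DISCHARGED in substance** (J1:Prop5.10.1, p.30 l.11–18: «there is a natural action of `Out(Π)` where `Π =
Π^temp_{X/E}` on `𝔍_SB(X,E)`»): on isomorphism classes the `Aut(Π)`-action kills `Inn(Π)`, i.e. it FACTORS THROUGH `Out(Π) =
Aut(Π)/Inn(Π)` — for all of `𝔍(X,E)`, a fortiori for the stable subspace `𝔍_SB` (print's strict-Belyi hypothesis serves to realise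
the action on the single scheme `Y ≅ X`, Prop. 5.9.1 (1)). [folklore] -/
theorem relabelClass_conj (g : X.PiTemp) (c : IsoClass X) : relabelClass (conjEquiv g) c = c := by
  induction c using Quotient.ind with
  | _ A => exact Quotient.sound (isIso_relabel_conj A g)

/-- The action laws on classes: identity. [folklore] -/
theorem relabelClass_refl (c : IsoClass X) : relabelClass (ContinuousMulEquiv.refl _) c = c := by
  induction c using Quotient.ind with
  | _ A => exact congrArg (Quotient.mk (isoSetoid X)) (relabel_refl A)

/-- The action laws on classes: composition. [folklore] -/
theorem relabelClass_trans (σ τ : X.PiTemp ≃ₜ* X.PiTemp) (c : IsoClass X) :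
    relabelClass (σ.trans τ) c = relabelClass τ (relabelClass σ c) := by
  induction c using Quotient.ind with
  | _ A => exact congrArg (Quotient.mk (isoSetoid X)) (relabel_trans σ τ A)

/-- Two automorphisms that differ by an inner one act identically on classes (`Out(Π)`-action). [folklore] -/
theorem relabelClass_trans_conj (σ : X.PiTemp ≃ₜ* X.PiTemp) (g : X.PiTemp) (c : IsoClass X) :
    relabelClass ((conjEquiv g).trans σ) c = relabelClass σ c := by
  rw [relabelClass_trans, relabelClass_conj]

end ATSObj

end Summit.ABC.IUTFork.Joshi

end
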